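import Summits.NavierStokesRegularity.FunctionalMining.StretchingLaminateCalculus
import Summits.NavierStokesRegularity.FunctionalMining.StretchingHolderBound
import Mathlib.Tactic.Linarith
import HarnessLib

/-!
# FunctionalMining — K1-Q1 lamination trees RESPECT THE HÖLDER CEILING `2/√3` (dict seat, staged)

NS FUNCTIONAL MINING cell (`pub-nsfunc`), dictionary seat gen 8 — **search for candidate a priori
estimates; no regularity claim.** STATIC, finite bookkeeping only: nothing about Navier–Stokes solutions
is asserted anywhere in this file, and no field on the torus appears.

The tree-level twin of the tree's `stretchingSupConst_le_holder` (`C⋆ ≤ 2/√3`, `StretchingHolderBound`):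
for every VALID lamination tree `𝒯` of `StretchingLaminates` (splits with `0 < λ < 1` and `c · n = 0`)

  `|σ(𝒯)| ≤ (2/√3) · M · E(𝒯)` whenever `M ≥ 0` and `M²(𝒯) ≤ M²`   (`Tree.abs_sigma_le_holder`),

hence `3 σ(𝒯)² ≤ 4 M²(𝒯) E(𝒯)²` in `ℚ` (`Tree.sigma_sq_le`) and **no lamination certificate can exceed the
Hölder ceiling: `𝒯.cert r = true → r² ≤ 4/3`** (`Tree.cert_sq_le`). UNCONDITIONAL (no `LaminateRealization`):
the laminate lower-bound method of `K1Q1-LAMINATES.md` can never contradict the kernel upper bound, and the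
bank's question K1-Q1″ ("is `C_lam < 2/√3` certifiable?") is exactly the question of a STRICT tree-level
deficit — which the kernel's non-sharpness `C⋆ < 2/√3` (p205451) gives only THROUGH realization.

Mechanism (pure algebra, mirroring the field proof leaf by leaf): div-free splits are TRACE-FREE
(`tr(c ⊗ n) = c·n = 0`), so every node state `G` is trace-free (`Tree` induction); at a leaf the tree's
pointwise lemma `HolderStretching.quadForm_sq_le_two_thirds` (`(ωᵀSω)² ≤ (2/3)|S|_F²|ω|⁴` for trace-free `S`)
and `(|S|² + ½|ω|²)² ≥ 2|S|²|ω|²` give `|ωᵀSω| ≤ (M/√3)(|S|_F² + ½|ω|²) = (M/√3)|G|²` (the identity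
`|G|² = |S|² + ½|ω|²`, `Grad.two_halfGradSq_eq`); summing over leaves with the (nonnegative) weights,
`|σ| ≤ (M/√3) · 2E`. Everything is [ours; elementary algebra / bookkeeping] on top of the tree's [folklore]
pointwise lemma; no literature fact is restated (LEAN PLACEMENT RULE).
-/

namespace Summit.NavierStokesRegularity.FunctionalMining

namespace Laminate

open Finset

namespace Grad

/-- `tr G`. [ours; bookkeeping] -/
def trace (G : Grad) : ℚ := G.g00 + G.g11 + G.g22

/-- `|S_G|_F²` for `S_G = (G + Gᵀ)/2`. [ours; bookkeeping] -/
def sSq (G : Grad) : ℚ :=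
  G.g00 * G.g00 + G.g11 * G.g11 + G.g22 * G.g22
    + ((G.g01 + G.g10) * (G.g01 + G.g10) + (G.g02 + G.g20) * (G.g02 + G.g20)
        + (G.g12 + G.g21) * (G.g12 + G.g21)) / 2

/-- `tr 0 = 0`. [ours; bookkeeping] -/
theorem trace_zero : Grad.zero.trace = 0 := by simp [zero, trace]

/-- Trace is affine along a layer: `tr(G + t c⊗n) = tr G + t (c·n)`. [ours; elementary] -/
theorem trace_layer (G : Grad) (t : ℚ) (s : Split) : (G.layer t s).trace = G.trace + t * s.dot := by
  simp only [layer, trace, Split.dot]; ring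

/-- `|G|² = |S|² + ½|ω|²` (symmetric/antisymmetric split), in the form `2·½|G|² = |S|² + ½|ω|²`.
[ours; elementary] -/
theorem two_halfGradSq_eq (G : Grad) : 2 * G.halfGradSq = G.sSq + G.vortSq / 2 := by
  simp only [halfGradSq, sSq, vortSq, vort0, vort1, vort2]; ring

/-- **Pointwise Hölder bound at a trace-free state** (real form): `|ωᵀS_Gω| ≤ (M/√3) · 2·½|G|²` whenever
`|ω(G)|² ≤ M²`, `M ≥ 0`, `tr G = 0`. From the tree's `HolderStretching.quadForm_sq_le_two_thirds`.
[ours; elementary, on a folklore pointwise lemma] -/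
theorem abs_stretch_le_holder (G : Grad) (htr : G.trace = 0) {M : ℝ} (hM : 0 ≤ M)
    (hω : (G.vortSq : ℝ) ≤ M ^ 2) :
    |(G.stretch : ℝ)| ≤ M / Real.sqrt 3 * (2 * (G.halfGradSq : ℝ)) := by
  -- the symmetric part as a real array, and the vorticity as a real vector
  set S : Fin 3 → Fin 3 → ℝ :=
    ![![(G.g00 : ℝ), ((G.g01 + G.g10 : ℚ) : ℝ) / 2, ((G.g02 + G.g20 : ℚ) : ℝ) / 2],
      ![((G.g01 + G.g10 : ℚ) : ℝ) / 2, (G.g11 : ℝ), ((G.g12 + G.g21 : ℚ) : ℝ) / 2],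
      ![((G.g02 + G.g20 : ℚ) : ℝ) / 2, ((G.g12 + G.g21 : ℚ) : ℝ) / 2, (G.g22 : ℝ)]] with hS
  set w : Fin 3 → ℝ := ![(G.vort0 : ℝ), (G.vort1 : ℝ), (G.vort2 : ℝ)] with hw
  have htrS : ∑ i, S i i = 0 := by
    have h : ((G.g00 + G.g11 + G.g22 : ℚ) : ℝ) = 0 := by
      have := htr; simp only [trace] at this; exact_mod_cast this
    simp only [Fin.sum_univ_three, hS]
    simp
    push_cast at h
    linarith
  have hCS := HolderStretching.quadForm_sq_le_two_thirds S htrS w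
  -- identify the three sums with the rational quantities
  have hQ : ∑ i, ∑ j, w i * S i j * w j = (G.stretch : ℝ) := by
    simp only [Fin.sum_univ_three, hS, hw, stretch]
    simp
    ring
  have hx : ∑ i, ∑ j, S i j ^ 2 = (G.sSq : ℝ) := by
    simp only [Fin.sum_univ_three, hS, sSq]
    simp
    ring
  have hn : ∑ i, w i ^ 2 = (G.vortSq : ℝ) := by
    simp only [Fin.sum_univ_three, hw, vortSq]
    simp
    ring
  rw [hQ, hx, hn] at hCS
  -- squaring argument, as in the tree's `cubeTrace_sub_stretchCubic_le_holder`
  set Q : ℝ := (G.stretch : ℝ)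
  set x : ℝ := (G.sSq : ℝ)
  set wsq : ℝ := (G.vortSq : ℝ)
  have hx0 : 0 ≤ x := by rw [← hx]; positivity
  have hw0 : 0 ≤ wsq := by rw [← hn]; positivity
  have h3 : 0 < Real.sqrt 3 := Real.sqrt_pos.2 (by norm_num)
  have hsq3 : Real.sqrt 3 ^ 2 = 3 := Real.sq_sqrt (by norm_num)
  have hQ2' : Q ^ 2 ≤ 2 / 3 * x * wsq * M ^ 2 := by
    calc Q ^ 2 ≤ 2 / 3 * x * wsq ^ 2 := hCS
      _ = 2 / 3 * x * wsq * wsq := by ring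
      _ ≤ 2 / 3 * x * wsq * M ^ 2 := mul_le_mul_of_nonneg_left hω (by positivity)
  have hG : 2 * (G.halfGradSq : ℝ) = x + 2⁻¹ * wsq := by
    have := two_halfGradSq_eq G
    have h' : ((2 * G.halfGradSq : ℚ) : ℝ) = ((G.sSq + G.vortSq / 2 : ℚ) : ℝ) := by rw [this]
    push_cast at h'
    linarith
  set R : ℝ := M / Real.sqrt 3 * (x + 2⁻¹ * wsq) with hR
  have hR0 : 0 ≤ R := by positivity
  have hR2 : 2 / 3 * x * wsq * M ^ 2 ≤ R ^ 2 := by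
    have hRsq : R ^ 2 = M ^ 2 / 3 * (x + 2⁻¹ * wsq) ^ 2 := by
      rw [hR, mul_pow, div_pow, hsq3]
    rw [hRsq]
    nlinarith [sq_nonneg (x - 2⁻¹ * wsq), sq_nonneg M, hx0, hw0]
  rw [hG]
  exact abs_le_of_sq_le_sq' (hQ2'.trans hR2) hR0 |> fun h => abs_le.2 h

end Grad

namespace Tree

/-- The children of a node carry at most the node's `vortSupFrom` (it is their maximum). [ours; bookkeeping] -/
theorem vortSupFrom_children (s : Split) (p m : Tree) (G : Grad) :
    p.vortSupFrom (G.layer (1 - s.lam) s) ≤ (node s p m).vortSupFrom G ∧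
      m.vortSupFrom (G.layer (-s.lam) s) ≤ (node s p m).vortSupFrom G := by
  simp only [vortSupFrom]
  split_ifs with h
  · exact ⟨h, le_rfl⟩
  · exact ⟨le_rfl, le_of_lt (lt_of_not_ge h)⟩

/-- **Hölder along the tree.** For a valid tree below a trace-free state `G` with weight `W ≥ 0` and
leaf vorticities bounded by `M²` (`vortSupFrom G 𝒯 ≤ M²`, `M ≥ 0`):
`|stretchFrom G W 𝒯| ≤ (M/√3) · 2 · energyFrom G W 𝒯`. [ours; elementary] -/
theorem abs_stretchFrom_le_holder (T : Tree) (hT : T.valid = true) {M : ℝ} (hM : 0 ≤ M) :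
    ∀ (G : Grad) (W : ℚ), G.trace = 0 → 0 ≤ W → (T.vortSupFrom G : ℝ) ≤ M ^ 2 →
      |(T.stretchFrom G W : ℝ)| ≤ M / Real.sqrt 3 * (2 * (T.energyFrom G W : ℝ)) := by
  induction T with
  | leaf =>
      intro G W htr hW hsup
      simp only [vortSupFrom] at hsup
      simp only [stretchFrom, energyFrom]
      have h := Grad.abs_stretch_le_holder G htr hM hsup
      have hW' : (0 : ℝ) ≤ (W : ℝ) := by exact_mod_cast hW
      push_cast
      rw [abs_mul, abs_of_nonneg hW']
      calc (W : ℝ) * |(G.stretch : ℝ)| ≤ (W : ℝ) * (M / Real.sqrt 3 * (2 * (G.halfGradSq : ℝ))) :=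
            mul_le_mul_of_nonneg_left h hW'
        _ = M / Real.sqrt 3 * (2 * ((W : ℝ) * (G.halfGradSq : ℝ))) := by ring
  | node s p m ihp ihm =>
      intro G W htr hW hsup
      obtain ⟨h0, h1, hdot, hp, hm⟩ := valid_node hT
      have hc := vortSupFrom_children s p m G
      have hsupP : (p.vortSupFrom (G.layer (1 - s.lam) s) : ℝ) ≤ M ^ 2 :=
        le_trans (by exact_mod_cast hc.1) hsup
      have hsupM : (m.vortSupFrom (G.layer (-s.lam) s) : ℝ) ≤ M ^ 2 :=
        le_trans (by exact_mod_cast hc.2) hsup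
      have htrP : (G.layer (1 - s.lam) s).trace = 0 := by rw [Grad.trace_layer, htr, hdot]; ring
      have htrM : (G.layer (-s.lam) s).trace = 0 := by rw [Grad.trace_layer, htr, hdot]; ring
      have hWP : 0 ≤ W * s.lam := mul_nonneg hW h0.le
      have hWM : 0 ≤ W * (1 - s.lam) := mul_nonneg hW (by linarith)
      have hP := ihp hp _ _ htrP hWP hsupP
      have hMm := ihm hm _ _ htrM hWM hsupM
      simp only [stretchFrom, energyFrom]
      push_cast
      calc |(stretchFrom (G.layer (1 - s.lam) s) (W * s.lam) p : ℝ)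
              + (stretchFrom (G.layer (-s.lam) s) (W * (1 - s.lam)) m : ℝ)|
            ≤ |(stretchFrom (G.layer (1 - s.lam) s) (W * s.lam) p : ℝ)|
              + |(stretchFrom (G.layer (-s.lam) s) (W * (1 - s.lam)) m : ℝ)| := abs_add_le _ _
        _ ≤ M / Real.sqrt 3 * (2 * (energyFrom (G.layer (1 - s.lam) s) (W * s.lam) p : ℝ))
              + M / Real.sqrt 3 * (2 * (energyFrom (G.layer (-s.lam) s) (W * (1 - s.lam)) m : ℝ)) :=
            add_le_add hP hMm
        _ = _ := by ring

/-- **Every valid lamination tree respects the Hölder ceiling**: `|σ(𝒯)| ≤ (2/√3)·M·E(𝒯)` whenever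
`M ≥ 0` and `M²(𝒯) ≤ M²` — the tree-level twin of `stretchingSupConst_le_holder`, UNCONDITIONAL (no
realization needed). [ours; elementary] -/
theorem abs_sigma_le_holder (T : Tree) (hT : T.valid = true) {M : ℝ} (hM : 0 ≤ M)
    (hsup : (T.vortSup : ℝ) ≤ M ^ 2) :
    |(T.sigma : ℝ)| ≤ 2 / Real.sqrt 3 * M * (T.energy : ℝ) := by
  have h := abs_stretchFrom_le_holder T hT hM Grad.zero 1 Grad.trace_zero zero_le_one hsup
  simp only [sigma, energy]
  calc |(stretchFrom Grad.zero 1 T : ℝ)| ≤ M / Real.sqrt 3 * (2 * (energyFrom Grad.zero 1 T : ℝ)) := h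
    _ = 2 / Real.sqrt 3 * M * (energyFrom Grad.zero 1 T : ℝ) := by ring

/-- Rational form: **`3 σ(𝒯)² ≤ 4 M²(𝒯) E(𝒯)²`** for every valid tree. [ours; elementary] -/
theorem sigma_sq_le (T : Tree) (hT : T.valid = true) : 3 * T.sigma ^ 2 ≤ 4 * T.vortSup * T.energy ^ 2 := by
  have hV : 0 ≤ T.vortSup := le_trans (Grad.vortSq_nonneg _) (vortSq_le_vortSupFrom T hT Grad.zero)
  have hE : 0 ≤ T.energy := energy_nonneg_of_valid T hT
  set M : ℝ := Real.sqrt (T.vortSup : ℝ) with hMdef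
  have hM : 0 ≤ M := Real.sqrt_nonneg _
  have hM2 : M ^ 2 = (T.vortSup : ℝ) := Real.sq_sqrt (by exact_mod_cast hV)
  have h := abs_sigma_le_holder T hT hM hM2.ge
  have h3 : Real.sqrt 3 ^ 2 = 3 := Real.sq_sqrt (by norm_num)
  have h3p : 0 < Real.sqrt 3 := Real.sqrt_pos.2 (by norm_num)
  have hE' : (0 : ℝ) ≤ (T.energy : ℝ) := by exact_mod_cast hE
  -- square both sides
  have hsq : (T.sigma : ℝ) ^ 2 ≤ (2 / Real.sqrt 3 * M * (T.energy : ℝ)) ^ 2 := by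
    have hr : 0 ≤ 2 / Real.sqrt 3 * M * (T.energy : ℝ) := by positivity
    calc (T.sigma : ℝ) ^ 2 = |(T.sigma : ℝ)| ^ 2 := (sq_abs _).symm
      _ ≤ (2 / Real.sqrt 3 * M * (T.energy : ℝ)) ^ 2 := pow_le_pow_left₀ (abs_nonneg _) h 2
  have hexp : (2 / Real.sqrt 3 * M * (T.energy : ℝ)) ^ 2 = 4 / 3 * (T.vortSup : ℝ) * (T.energy : ℝ) ^ 2 := by
    rw [mul_pow, mul_pow, div_pow, h3, hM2]; ring
  rw [hexp] at hsq
  have : (3 : ℝ) * (T.sigma : ℝ) ^ 2 ≤ 4 * (T.vortSup : ℝ) * (T.energy : ℝ) ^ 2 := by linarith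
  exact_mod_cast this

/-- **No lamination certificate exceeds the Hölder ceiling**: `𝒯.cert r = true → r² ≤ 4/3`, i.e. `r ≤ 2/√3`,
for every tree and every rational `r` — UNCONDITIONAL kernel sanity bound on the whole laminate programme
(`board` 1/2, `treeD4` 69/125, `treeG7` 1279/2000, and any future tree). [ours; elementary] -/
theorem cert_sq_le (T : Tree) {r : ℚ} (hc : T.cert r = true) : r ^ 2 ≤ 4 / 3 := by
  simp only [cert, Bool.and_eq_true, decide_eq_true_eq] at hc
  obtain ⟨⟨⟨⟨⟨hv, hr⟩, hσ⟩, hE⟩, hV⟩, hcert⟩ := hc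
  have hH := sigma_sq_le T hv
  -- `r² (E² M²) ≤ σ² ≤ (4/3) M² E²`, and `E² M² > 0` because `σ > 0` forces it
  have hpos : 0 < T.vortSup * T.energy ^ 2 := by
    rcases (mul_nonneg hV (sq_nonneg T.energy)).eq_or_lt with h | h
    · exfalso
      have h' : 4 * T.vortSup * T.energy ^ 2 = 0 := by rw [mul_assoc, ← h, mul_zero]
      have : 3 * T.sigma ^ 2 ≤ 0 := by rw [h'] at hH; exact hH
      nlinarith [hσ]
    · exact h
  have h1 : r * r * (T.energy * T.energy) * T.vortSup = r ^ 2 * (T.vortSup * T.energy ^ 2) := by ring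
  rw [h1] at hcert
  have h2 : r ^ 2 * (T.vortSup * T.energy ^ 2) ≤ 4 / 3 * (T.vortSup * T.energy ^ 2) := by nlinarith
  exact le_of_mul_le_mul_right h2 hpos

/-- In particular `r < 6/5` — e.g. no tree certifies `1.2 ≤ C⋆` (`(6/5)² = 36/25 > 4/3`). [ours; bookkeeping] -/
theorem cert_lt (T : Tree) {r : ℚ} (hc : T.cert r = true) : r < 6 / 5 := by
  have h := cert_sq_le T hc
  nlinarith

end Tree

end Laminate

end Summit.NavierStokesRegularity.FunctionalMining
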